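import Literature.MathematicalPhysics.QuantumFieldTheory.Balaban1983to89.B5G183RateSum

/-!
# Bałaban [CMP 95 (1984)] (1.83)/(1.89) at `U = 1`: the ORDER-ONE derivative-weighted finite-rank
vectors of the fibre of `G` in the `ℓ²` (Hilbert–Schmidt) currency — uniform bounds and the η-RATE
`O(1/N)` with NO loss (linear theory; King's squared alias weight is summable with no momentum power)

HONEST FRAMING (cell `pub-balaban`, T⁴ programme, estimate NE2 = U1a «η-rate, linear theory»).  This
module is the `ℓ²` companion of `B5G183RateSum` (per-class `ℓ¹` currency) and `B5G183RateOp` (Schur /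
operator currency) for Bałaban's operator `G` of (1.83) ([Balaban1984PropagatorsI] p. 31) on a FINITE torus
with lattice spacing `η = 1/n` and the trivial background `U = 1`, at a fixed NONZERO reduced momentum
`p′ = s` of the Brillouin zone.  Its point: the finite-rank part of the fibre of (1.83) is of PRODUCT form
(`xEnt(k,k′) = cX·xP_μ(q_k)·conj xP_μ(q_{k′})`, `rEnt = cB·bR_μ(q_k)·conj bR_ν(q_{k′})`, `B5G183RateSum`),
so the natural currency for the DERIVATIVE-WEIGHTED items `∇G`, `G∇*` of Prop. 1.1 (1.89) p. 33 is the
`ℓ²` norm of the weighted alias vectors `k ↦ w(k)·xP_μ(q_k)`, `k ↦ w(k)·bR_μ(q_k)` (`|w(k)| ≤ ‖q_k‖_∞`, one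
lattice derivative): there King's SQUARED alias weight `W(j)² = Π_μ (p′_μ/(p′_μ+2πj_μ))²` is summable
over `j ≠ 0` with NO power of the momentum spent ((4.22) at exponent 2), one power `‖q_k‖` per vector is
free, and the η-rate between the levels `N` and `RN` (King's `m = 0` pairing `ι` of `B5Hk163Rate`) keeps
the full currency `1/N` — whereas the `ℓ¹`/Schur currency of `B5G183RateOp` loses a logarithm / a power
`N^{−γ}` on the same items (column sums `Σ_k ‖q_k‖·xe_k·xM_k ~ N⁻¹Σ_j W(j)`).  Nothing here is
infinite-volume, a mass gap, uniform in a coupling, an operator-norm statement, or progress on any Clay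
problem or on the summit statement of this programme.  Bałaban prints NO η-rate for `G` (Prop. 1.1 is a
uniform bound); King's rates ([King1986] §4) are for the scalar kernels with averaging operators; the
bookkeeping below (pairing, currencies, constants) is OURS.  All theorems `[folklore]`; `[cite: …]` tags
locate TEXT, never a proof.

WHAT IS PRINTED (renders read as images by this seat: [Balaban1984PropagatorsI] pp. 31, 32, 33; [King1986]
p. 672).  Bałaban p. 33: «Proposition 1.1. The operator G is a symmetric operator on L²(T_η) and ‖GJ‖,
‖∇GJ‖, ‖G∇*J‖, ‖∇G∇*J‖, ‖∇∇GJ‖, ‖G∇*∇*J‖ ≤ γ₀⁻¹‖J‖, (1.89) with a positive constant γ₀ independent of k,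
T_η, and depending on d only (if we put a = 1).»; p. 32: «It is bounded also when differentiated two times
at most.»  King p. 672, legends of (4.22) «… ≤ C for α < 1.» and (4.23) «≤ CL^{−γk} for α + γ < 1», and «To
analyze the m = 0 term in (4.19), we successively replace each factor by the corresponding one … and bound
the error. We must always be careful to keep enough negative powers of momentum so that» (the alias sums
converge).  The typed (1.83) fibre is b05's reviewed `B5Prop11Fiber.balabanFiber` / `B5G183Rate.xP`, `bR`;
its order-one weights are b05's `B5Prop11Fiber.dSym n k p′ ν = ∂^{(n)}_ν(p′ + 2πk)` (the `w₁`, `w₂` of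
`B5Prop11Bound.sandwich` in `B5Prop11Fiber.opNorm_D_G_le` / `opNorm_G_D_le`).

WHAT IS TYPED HERE (classes `k : Fin d → Fin n` of `(ℤ/n)^d`, symmetric representatives `q_k = symmAlias n k
p′` of `King1986`, majorants `xM`, `xe`, `bM`, `be` and constants `CXa`, `CBa`, `Ax`, `Ab`, `Bb`, `MrS`, `SBe`
of `B5G183Rate` / `B5G183RateSum`; `|p′_ν| ≤ π`, `p′ ≠ 0`, `0 < a`, `1 ≤ N`, `1 ≤ R`):
 * §0 `sum_aliasWeight_sq_le`: `Σ_{j ∈ box∖0} W(j)² ≤ CW(d) := π^d((1 + 4/π)^d − 1)` (from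
   `King1986.sum_aliasMaj_le` at exponent `s = 2`), and the transfer lemma `sum_le_of_aliasSq_bound` from a
   per-class bound `F k ≤ B·W(j(k))²` to `Σ_k F k ≤ B·CW`;
 * §1–§2 per class and summed over the classes `k ≠ 0` of level `N`: `‖q_k‖²·xM_k² ≤ (CXa/π)²W²`,
   `‖q_k‖⁴·xM_k² ≤ CXa²W²`, **`‖q_k‖²·(xe_k·xM_k)² ≤ (Ax·d·CXa/N)²W²`** (the η-rate, squared, `O(N⁻²)`), the
   bracket analogues with `bM`, `be`, the CENTRE class `k = 0` of the bracket vector ((1.88) form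
   `bM_0 = |p′_μ|·MrS`), and the UNPAIRED classes of level `RN` (no level-`N` partner under `ι`; `‖q″‖ ≥ πN`):
   `Σ ‖q″‖²·xM² ≤ (CXa/(πN))²·CW`, `Σ ‖q″‖²·bM² ≤ (CBa/(πN))²·CW`;
 * §3 for ABSTRACT order-one weights (`|w^{(N)}(k)| ≤ ‖q_k‖`, paired rate `|w^{(RN)}(ιk) − w^{(N)}(k)| ≤
   c_w‖q_k‖²/N`): `xVec_sq_le` (`Σ_{k≠0} |w·xP^{(N)}_μ(q_k)|² ≤ (CXa/π)²CW`), `xVec_unpaired_sq_le`,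
   **`xVec_rate_sq_le`** (`Σ_{k≠0} |w^{(N)}(k)xP^{(N)}_μ(q_k) − w^{(RN)}(ιk)xP^{(RN)}_μ(q_k)|² ≤ 2((Ax·d·CXa)² +
   (c_w·CXa)²)·CW/N²`), and `bVec_sq_le`, `bVec_unpaired_sq_le`, **`bVec_rate_sq_le`** (`≤ CbRate(d,a,c_w)/N²`,
   ALL classes incl. the centre);
 * §4 the INSTANCE `w = dSym`: `dSym_eq_symmAlias` (`∂^{(n)}_ν` through the symmetric representative, by
   `2πn`-periodicity), `norm_dSym_le` (`|∂^{(n)}_ν(q)| ≤ ‖q̃‖_∞`), `dSym_rate_le` (`|∂^{(RN)}_ν(ιk) −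
   ∂^{(N)}_ν(k)| ≤ 6‖q̃_k‖²/N`, via `‖e^{it} − 1 − it‖ ≤ 3t²` for all real `t`), hence `xVec_sq_le_dSym`,
   `xVec_unpaired_sq_le_dSym`, **`xVec_rate_sq_le_dSym`**, `bVec_sq_le_dSym`, `bVec_unpaired_sq_le_dSym`,
   **`bVec_rate_sq_le_dSym`** (`c_w = 6`).
 NO conditional of the cell is used or mentioned in any signature (no BetaPertH / (B) / (B^μ)): linear theory.

WHAT IS NOT CLAIMED: (i) any OPERATOR-NORM statement about the sandwiches `D_{∂_ν}G^{(RN)} − plant(D_{∂_ν}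
G^{(N)})` — the assembly (Hilbert–Schmidt calculus for the product-form blocks with the level-dependent
coefficients `cX`, `cB`, the diagonal `∂_ν/Δ` by a sup bound, the `k = 0` row / column / (1.87)-corner of the
x-block, and the planting of `B5G183RateOp`) is the cell's typed residual S2 and is NOT done here; (ii)
anything for the ORDER-TWO items of (1.89), whose free-diagonal weight has NO uniform η-rate at symbol level
(`B5G183RateObstruction.order_two_weight_no_rate`); (iii) `p′`-derivatives, the momentum integral / the
position-space kernels and their decay, `U ≠ 1`, optimal constants (`CW`, `6`, `CbRate` are crude); (iv) any
claim about print beyond the located quotations above.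
-/

noncomputable section

namespace Literature.MathematicalPhysics.QuantumFieldTheory.Balaban1983to89.B5G183RateL2

open scoped BigOperators ComplexConjugate
open Finset Complex
open Literature.MathematicalPhysics.QuantumFieldTheory.Balaban1983to89.B4Strip
open Literature.MathematicalPhysics.QuantumFieldTheory.Balaban1983to89.B5Prop11Leaves
open Literature.MathematicalPhysics.QuantumFieldTheory.Balaban1983to89.B5ActionRate166 (Cphi Cpsi)
open Literature.MathematicalPhysics.QuantumFieldTheory.Balaban1983to89.B5Hk163Rate
open Literature.MathematicalPhysics.QuantumFieldTheory.Balaban1983to89.B5Hk163RateSum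
open Literature.MathematicalPhysics.QuantumFieldTheory.Balaban1983to89.B5G183Rate
open Literature.MathematicalPhysics.QuantumFieldTheory.Balaban1983to89.B5G183RateSum
open Literature.MathematicalPhysics.QuantumFieldTheory.King1986

variable {d : ℕ}

/-! ## §0 King's one-coordinate machinery at `s = 2`: the SQUARED alias weight is summable with no
momentum power at all (`Σ_{j ≠ 0} W(j)² ≤ CW(d)`, uniformly in `p′` and the window) -/

/-- one coordinate: the squared weight factor is `≤ π·aliasMaj 2` (`|p′_μ| ≤ π ≤ |p′_μ + 2πi|` for `i ≠ 0`;
`1 ≤ π` for `i = 0`). [cite: King1986, (4.20)–(4.22) p.672] [folklore] -/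
theorem weightFactor_sq_le {p : ℝ} (hp : |p| ≤ Real.pi) (i : ℤ) :
    (if i = 0 then (1 : ℝ) else |p| / |p + 2 * Real.pi * i|) ^ 2 ≤ Real.pi * aliasMaj 2 p i := by
  unfold aliasMaj
  by_cases hi : i = 0
  · rw [if_pos hi, if_pos hi, one_pow, mul_one]
    linarith [Real.pi_gt_three]
  · rw [if_neg hi, if_neg hi]
    have hx : Real.pi ≤ |p + 2 * Real.pi * i| := pi_le_abs_add hp hi
    have hx0 : 0 < |p + 2 * Real.pi * i| := lt_of_lt_of_le Real.pi_pos hx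
    have hp0 : 0 ≤ |p| := abs_nonneg p
    rw [show (-2 : ℝ) = -(2 : ℝ) by norm_num, Real.rpow_neg hx0.le, Real.rpow_two, div_pow]
    rw [div_le_iff₀ (by positivity)]
    calc |p| ^ 2 ≤ Real.pi ^ 2 := pow_le_pow_left₀ hp0 hp 2
      _ = Real.pi * (Real.pi * (|p + 2 * Real.pi * ↑i| ^ 2)⁻¹) * |p + 2 * Real.pi * ↑i| ^ 2 := by
          rw [mul_assoc, mul_assoc, inv_mul_cancel₀ (pow_ne_zero 2 hx0.ne'), mul_one, sq]

/-- `W(j)² ≤ π^d · Π_μ aliasMaj 2 (p′_μ) (j_μ)`. [cite: King1986, (4.22) p.672] [folklore] -/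
theorem aliasWeight_sq_le {p : Fin d → ℝ} (hp : ∀ μ, |p μ| ≤ Real.pi) (j : Fin d → ℤ) :
    aliasWeight p j ^ 2 ≤ Real.pi ^ d * ∏ μ, aliasMaj 2 (p μ) (j μ) := by
  unfold aliasWeight
  rw [← Finset.prod_pow]
  calc ∏ μ, (if j μ = 0 then (1 : ℝ) else |p μ| / |p μ + 2 * Real.pi * j μ|) ^ 2
      ≤ ∏ μ, (Real.pi * aliasMaj 2 (p μ) (j μ)) :=
        Finset.prod_le_prod (fun μ _ => sq_nonneg _) (fun μ _ => weightFactor_sq_le (hp μ) (j μ))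
    _ = Real.pi ^ d * ∏ μ, aliasMaj 2 (p μ) (j μ) := by
        rw [Finset.prod_mul_distrib, Finset.prod_const, Finset.card_univ, Fintype.card_fin]

/-- the constant of `Σ_{j ≠ 0} W(j)²`: `π^d·((1 + 4/π)^d − 1)` (King's one-coordinate bound at `s = 2`:
`Σ_i aliasMaj 2 ≤ 1 + 2π^{−1}·2`). [folklore] -/
def CW (d : ℕ) : ℝ := Real.pi ^ d * ((1 + 4 / Real.pi) ^ d - 1)

/-- `CW ≥ 0`. [folklore] -/
theorem CW_nonneg (d : ℕ) : 0 ≤ CW d := by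
  have hπ := Real.pi_pos
  have h1 : (1 : ℝ) ≤ 1 + 4 / Real.pi := by
    have : 0 ≤ 4 / Real.pi := by positivity
    linarith
  have h2 : (1 : ℝ) ≤ (1 + 4 / Real.pi) ^ d := one_le_pow₀ h1
  unfold CW
  exact mul_nonneg (by positivity) (by linarith)

/-- **`Σ_{j ∈ [−N,N]^d, j ≠ 0} W(j)² ≤ CW(d)`**, uniformly in `p′` (`|p′_μ| ≤ π`) and `N`: the product of
the one-coordinate sums minus the `j = 0` term. [cite: King1986, (4.22) p.672] [folklore] -/
theorem sum_aliasWeight_sq_le {p : Fin d → ℝ} (hp : ∀ μ, |p μ| ≤ Real.pi) (N : ℕ) :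
    ∑ j ∈ (aliasBox d N).erase 0, aliasWeight p j ^ 2 ≤ CW d := by
  classical
  have hπ := Real.pi_pos
  have h1 : ∑ j ∈ (aliasBox d N).erase 0, aliasWeight p j ^ 2
      ≤ ∑ j ∈ (aliasBox d N).erase 0, Real.pi ^ d * ∏ μ, aliasMaj 2 (p μ) (j μ) :=
    Finset.sum_le_sum fun j _ => aliasWeight_sq_le hp j
  have h0 : ∏ μ : Fin d, aliasMaj 2 (p μ) ((0 : Fin d → ℤ) μ) = 1 := by simp [aliasMaj]
  have h2 : ∑ j ∈ (aliasBox d N).erase 0, ∏ μ, aliasMaj 2 (p μ) (j μ)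
      = (∏ μ : Fin d, ∑ i ∈ Finset.Icc (-(N : ℤ)) N, aliasMaj 2 (p μ) i) - 1 := by
    have hz := zero_mem_aliasBox d N
    rw [Finset.prod_univ_sum]
    unfold aliasBox at hz ⊢
    rw [← Finset.add_sum_erase _ _ hz, h0]
    ring
  have hone : ∀ μ : Fin d, ∑ i ∈ Finset.Icc (-(N : ℤ)) N, aliasMaj 2 (p μ) i ≤ 1 + 4 / Real.pi := by
    intro μ
    have h := sum_aliasMaj_le (s := 2) (by norm_num) (hp μ) N
    have e : (1 : ℝ) + 2 * Real.pi ^ (1 - (2 : ℝ)) * (2 / (2 - 1)) = 1 + 4 / Real.pi := by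
      rw [show (1 : ℝ) - 2 = -1 by norm_num, Real.rpow_neg_one]
      field_simp
      ring
    rwa [e] at h
  have h3 : ∏ μ : Fin d, ∑ i ∈ Finset.Icc (-(N : ℤ)) N, aliasMaj 2 (p μ) i ≤ (1 + 4 / Real.pi) ^ d := by
    calc ∏ μ : Fin d, ∑ i ∈ Finset.Icc (-(N : ℤ)) N, aliasMaj 2 (p μ) i
        ≤ ∏ _μ : Fin d, (1 + 4 / Real.pi) :=
          Finset.prod_le_prod (fun μ _ => Finset.sum_nonneg fun i _ => aliasMaj_nonneg _ _ _)
            (fun μ _ => hone μ)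
      _ = (1 + 4 / Real.pi) ^ d := by rw [Finset.prod_const, Finset.card_univ, Fintype.card_fin]
  calc ∑ j ∈ (aliasBox d N).erase 0, aliasWeight p j ^ 2
      ≤ Real.pi ^ d * ∑ j ∈ (aliasBox d N).erase 0, ∏ μ, aliasMaj 2 (p μ) (j μ) := by
        rw [Finset.mul_sum]; exact h1
    _ = Real.pi ^ d * ((∏ μ : Fin d, ∑ i ∈ Finset.Icc (-(N : ℤ)) N, aliasMaj 2 (p μ) i) - 1) := by rw [h2]
    _ ≤ Real.pi ^ d * ((1 + 4 / Real.pi) ^ d - 1) := by gcongr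
    _ = CW d := rfl

/-- the same for any finite family of NONZERO integer vectors (it sits in a window; the terms are `≥ 0`).
[cite: King1986, (4.22)–(4.23) p.672] [folklore] -/
theorem sum_aliasWeight_sq_le_of_subset {p : Fin d → ℝ} (hp : ∀ μ, |p μ| ≤ Real.pi)
    {Λ : Finset (Fin d → ℤ)} (h0 : (0 : Fin d → ℤ) ∉ Λ) : ∑ j ∈ Λ, aliasWeight p j ^ 2 ≤ CW d := by
  classical
  obtain ⟨N, hN⟩ : ∃ N : ℕ, ∀ j ∈ Λ, ∀ μ, |j μ| ≤ N := by
    refine ⟨Λ.sup fun j => Finset.univ.sup fun μ => (j μ).natAbs, fun j hj μ => ?_⟩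
    have h1 : (j μ).natAbs ≤ Finset.univ.sup fun μ => (j μ).natAbs :=
      Finset.le_sup (f := fun μ => (j μ).natAbs) (Finset.mem_univ μ)
    have h2 : (Finset.univ.sup fun μ => (j μ).natAbs)
        ≤ Λ.sup fun j => Finset.univ.sup fun μ => (j μ).natAbs :=
      Finset.le_sup (f := fun j => Finset.univ.sup fun μ => (j μ).natAbs) hj
    have := h1.trans h2
    rw [← Int.natCast_natAbs]
    exact_mod_cast this
  have hsub : Λ ⊆ (aliasBox d N).erase 0 := by
    intro j hj
    rw [Finset.mem_erase]
    refine ⟨fun h => h0 (h ▸ hj), ?_⟩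
    unfold aliasBox
    rw [Fintype.mem_piFinset]
    intro μ
    rw [Finset.mem_Icc]
    exact abs_le.1 (hN j hj μ)
  exact (Finset.sum_le_sum_of_subset_of_nonneg hsub fun j _ _ => sq_nonneg _).trans
    (sum_aliasWeight_sq_le hp N)

/-- a sum over torus classes with NONZERO alias vectors, each bounded by `B·W(jOf k)²`, is `≤ B·CW(d)`
(re-indexing by the injective `jOf`). [cite: King1986, (4.22) p.672] [folklore] -/
theorem sum_le_of_aliasSq_bound {M : ℕ} {p : Fin d → ℝ} (hp : ∀ ν, |p ν| ≤ Real.pi)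
    (S : Finset (Fin d → Fin M)) (F : (Fin d → Fin M) → ℝ) {B : ℝ} (hB : 0 ≤ B)
    (hne : ∀ k ∈ S, jOf M k p ≠ 0) (h1 : ∀ k ∈ S, F k ≤ B * aliasWeight p (jOf M k p) ^ 2) :
    ∑ k ∈ S, F k ≤ B * CW d := by
  classical
  calc ∑ k ∈ S, F k ≤ ∑ k ∈ S, B * aliasWeight p (jOf M k p) ^ 2 := Finset.sum_le_sum h1
    _ = B * ∑ k ∈ S, aliasWeight p (jOf M k p) ^ 2 := by rw [Finset.mul_sum]
    _ = B * ∑ j ∈ S.image (fun k => jOf M k p), aliasWeight p j ^ 2 := by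
        rw [Finset.sum_image fun k _ k' _ h => jOf_injective M p h]
    _ ≤ B * CW d := by
        gcongr
        refine sum_aliasWeight_sq_le_of_subset hp ?_
        intro h0
        obtain ⟨k, hk, hk0⟩ := Finset.mem_image.mp h0
        exact hne k hk hk0

/-! ## §1 The per-class majorants in the `ℓ²` currency: one and two powers of `‖q_k‖` against `xM_k`,
`bM_k` and their η-rate coefficients -/

section PerClass

variable {N R : ℕ} [NeZero N] [NeZero R]

omit [NeZero N] in
/-- `xM_k ≤ CXa·W(j_k)/‖q_k‖²` for `k ≠ 0` (`B5G183RateSum.xMaj_alias_le` at the symmetric representative).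
[cite: King1986, (4.20)–(4.21) p.672] [folklore] -/
theorem xM_le_W_div_sq {s : Fin d → ℝ} (hs : ∀ ν, |s ν| ≤ Real.pi) (μ : Fin d) {k : Fin d → Fin N}
    (hk : jOf N k s ≠ 0) :
    xM N s μ k ≤ CXa d * aliasWeight s (jOf N k s) / ‖symmAlias N k s‖ ^ 2 := by
  unfold xM
  rw [symmAlias_eq_aliasPt]
  exact xMaj_alias_le hs hk μ

omit [NeZero N] in
/-- **order-one weight, squared: `‖q_k‖²·xM_k² ≤ (CXa/π)²·W(j_k)²`** for `k ≠ 0` (`‖q_k‖ ≥ π` spends the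
spare `‖q_k‖⁻²`). [folklore] -/
theorem sq_mul_xM_sq_le {s : Fin d → ℝ} (hs : ∀ ν, |s ν| ≤ Real.pi) (μ : Fin d) {k : Fin d → Fin N}
    (hk : jOf N k s ≠ 0) :
    ‖symmAlias N k s‖ ^ 2 * xM N s μ k ^ 2 ≤ (CXa d / Real.pi) ^ 2 * aliasWeight s (jOf N k s) ^ 2 := by
  have hπ := Real.pi_pos
  set j := jOf N k s with hj
  have hq : symmAlias N k s = aliasPt s j := by rw [symmAlias_eq_aliasPt]
  have hx : Real.pi ≤ ‖aliasPt s j‖ := pi_le_norm_aliasPt hs hk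
  have hx0 : 0 < ‖aliasPt s j‖ := lt_of_lt_of_le hπ hx
  have hw := aliasWeight_nonneg s j
  have hC := CXa_nonneg d
  have h1 : xM N s μ k ≤ CXa d * aliasWeight s j / ‖aliasPt s j‖ ^ 2 := by
    have := xM_le_W_div_sq hs μ hk; rwa [hq] at this
  have h2 : xM N s μ k ^ 2 ≤ (CXa d * aliasWeight s j / ‖aliasPt s j‖ ^ 2) ^ 2 :=
    pow_le_pow_left₀ (xM_nonneg _ _ _) h1 2
  rw [hq]
  calc ‖aliasPt s j‖ ^ 2 * xM N s μ k ^ 2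
      ≤ ‖aliasPt s j‖ ^ 2 * (CXa d * aliasWeight s j / ‖aliasPt s j‖ ^ 2) ^ 2 :=
        mul_le_mul_of_nonneg_left h2 (sq_nonneg _)
    _ = (CXa d * aliasWeight s j) ^ 2 / ‖aliasPt s j‖ ^ 2 := by field_simp
    _ ≤ (CXa d * aliasWeight s j) ^ 2 / Real.pi ^ 2 := by
        gcongr
    _ = (CXa d / Real.pi) ^ 2 * aliasWeight s j ^ 2 := by field_simp

omit [NeZero N] in
/-- **order-two weight, squared: `‖q_k‖⁴·xM_k² ≤ CXa²·W(j_k)²`** for `k ≠ 0` — even TWO powers of momentum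
leave the x-vector square-summable over the classes (uniform bound, no rate). [folklore] -/
theorem pow_four_mul_xM_sq_le {s : Fin d → ℝ} (hs : ∀ ν, |s ν| ≤ Real.pi) (μ : Fin d) {k : Fin d → Fin N}
    (hk : jOf N k s ≠ 0) :
    ‖symmAlias N k s‖ ^ 4 * xM N s μ k ^ 2 ≤ CXa d ^ 2 * aliasWeight s (jOf N k s) ^ 2 := by
  have hπ := Real.pi_pos
  set j := jOf N k s with hj
  have hq : symmAlias N k s = aliasPt s j := by rw [symmAlias_eq_aliasPt]
  have hx0 : 0 < ‖aliasPt s j‖ := lt_of_lt_of_le hπ (pi_le_norm_aliasPt hs hk)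
  have h1 : xM N s μ k ≤ CXa d * aliasWeight s j / ‖aliasPt s j‖ ^ 2 := by
    have := xM_le_W_div_sq hs μ hk; rwa [hq] at this
  have h2 : xM N s μ k ^ 2 ≤ (CXa d * aliasWeight s j / ‖aliasPt s j‖ ^ 2) ^ 2 :=
    pow_le_pow_left₀ (xM_nonneg _ _ _) h1 2
  rw [hq]
  calc ‖aliasPt s j‖ ^ 4 * xM N s μ k ^ 2
      ≤ ‖aliasPt s j‖ ^ 4 * (CXa d * aliasWeight s j / ‖aliasPt s j‖ ^ 2) ^ 2 :=
        mul_le_mul_of_nonneg_left h2 (by positivity)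
    _ = CXa d ^ 2 * aliasWeight s j ^ 2 := by field_simp

omit [NeZero N] in
/-- **the η-rate coefficient with one power: `‖q_k‖²·(xe_k·xM_k)² ≤ (Ax·d·CXa/N)²·W(j_k)²`** for `k ≠ 0`
(`xe_k·xM_k ≤ (Ax·d·CXa/N)·‖q_k‖⁻¹·W`, `B5G183RateSum.xe_xM_le_aliasTerm`). [cite: King1986, (4.29)/(4.31)
p.673] [folklore] -/
theorem sq_mul_xe_xM_sq_le (hN : 1 ≤ N) {s : Fin d → ℝ} (hs : ∀ ν, |s ν| ≤ Real.pi) (μ : Fin d)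
    {k : Fin d → Fin N} (hk : jOf N k s ≠ 0) :
    ‖symmAlias N k s‖ ^ 2 * (xe N s k * xM N s μ k) ^ 2
      ≤ (Ax d * d * CXa d / N) ^ 2 * aliasWeight s (jOf N k s) ^ 2 := by
  have hπ := Real.pi_pos
  have hN0 : (0 : ℝ) < N := by exact_mod_cast hN
  set j := jOf N k s with hj
  have hq : symmAlias N k s = aliasPt s j := by rw [symmAlias_eq_aliasPt]
  have hx0 : 0 < ‖aliasPt s j‖ := lt_of_lt_of_le hπ (pi_le_norm_aliasPt hs hk)
  have hw := aliasWeight_nonneg s j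
  have hA : 0 ≤ Ax d := by unfold Ax; positivity
  have hC := CXa_nonneg d
  have h1 : xe N s k * xM N s μ k ≤ Ax d * d * CXa d / N * (‖aliasPt s j‖⁻¹ * aliasWeight s j) := by
    have h := xe_xM_le_aliasTerm hN hs μ hk
    unfold King1986.aliasTerm at h
    rwa [zero_sub, Real.rpow_neg_one] at h
  have h0 : 0 ≤ xe N s k * xM N s μ k := mul_nonneg (xe_nonneg s k) (xM_nonneg _ _ _)
  have h2 := pow_le_pow_left₀ h0 h1 2
  rw [hq]
  calc ‖aliasPt s j‖ ^ 2 * (xe N s k * xM N s μ k) ^ 2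
      ≤ ‖aliasPt s j‖ ^ 2 * (Ax d * d * CXa d / N * (‖aliasPt s j‖⁻¹ * aliasWeight s j)) ^ 2 :=
        mul_le_mul_of_nonneg_left h2 (sq_nonneg _)
    _ = (Ax d * d * CXa d / N) ^ 2 * aliasWeight s j ^ 2 := by field_simp

/-- **UNPAIRED level-`RN` classes, one power: `‖q″‖²·xM_{k″}² ≤ (CXa/(πN))²·W(j″)²`** — `‖q″‖ ≥ πN` turns the
spare `‖q″‖⁻²` into `N⁻²`. [cite: King1986, (4.23) p.672] [folklore] -/
theorem sq_mul_xM_sq_unpaired_le (hN : 1 ≤ N) {s : Fin d → ℝ} (hs : ∀ ν, |s ν| ≤ Real.pi) (μ : Fin d)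
    {k'' : Fin d → Fin (R * N)} (hu : ∀ k : Fin d → Fin N, iota R k s ≠ k'') :
    ‖symmAlias (R * N) k'' s‖ ^ 2 * xM (R * N) s μ k'' ^ 2
      ≤ (CXa d / (Real.pi * N)) ^ 2 * aliasWeight s (jOf (R * N) k'' s) ^ 2 := by
  have hπ := Real.pi_pos
  have hN0 : (0 : ℝ) < N := by exact_mod_cast hN
  have hj0 := jOf_ne_zero_of_unpaired hN hs hu
  set j := jOf (R * N) k'' s with hj
  have hq : symmAlias (R * N) k'' s = aliasPt s j := by rw [symmAlias_eq_aliasPt]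
  have hfar : Real.pi * N ≤ ‖aliasPt s j‖ := by rw [← hq]; exact norm_ge_of_unpaired hN hs hu
  have hx0 : 0 < ‖aliasPt s j‖ := lt_of_lt_of_le (by positivity) hfar
  have hw := aliasWeight_nonneg s j
  have hC := CXa_nonneg d
  have h1 : xM (R * N) s μ k'' ≤ CXa d * aliasWeight s j / ‖aliasPt s j‖ ^ 2 := by
    have := xM_le_W_div_sq hs μ hj0; rwa [hq] at this
  have h2 : xM (R * N) s μ k'' ^ 2 ≤ (CXa d * aliasWeight s j / ‖aliasPt s j‖ ^ 2) ^ 2 :=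
    pow_le_pow_left₀ (xM_nonneg _ _ _) h1 2
  rw [hq]
  calc ‖aliasPt s j‖ ^ 2 * xM (R * N) s μ k'' ^ 2
      ≤ ‖aliasPt s j‖ ^ 2 * (CXa d * aliasWeight s j / ‖aliasPt s j‖ ^ 2) ^ 2 :=
        mul_le_mul_of_nonneg_left h2 (sq_nonneg _)
    _ = (CXa d * aliasWeight s j) ^ 2 / ‖aliasPt s j‖ ^ 2 := by field_simp
    _ ≤ (CXa d * aliasWeight s j) ^ 2 / (Real.pi * N) ^ 2 := by gcongr
    _ = (CXa d / (Real.pi * N)) ^ 2 * aliasWeight s j ^ 2 := by field_simp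

/-! ### the bracket side (`bM`, `be`; the class `k = 0` is the centre form, bounded separately) -/

/-- `bM_k ≤ CBa·W(j_k)/‖q_k‖²` for `k ≠ 0`. [folklore] -/
theorem bM_le_W_div_sq (hN : 1 ≤ N) (a : ℝ) {s : Fin d → ℝ} (hs : ∀ ν, |s ν| ≤ Real.pi) (μ : Fin d)
    {k : Fin d → Fin N} (hk : jOf N k s ≠ 0) :
    bM N a s μ k ≤ CBa d * aliasWeight s (jOf N k s) / ‖symmAlias N k s‖ ^ 2 := by
  have hk' : k ≠ 0 := fun h => hk ((jOf_eq_zero_iff hN hs k).mpr h)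
  unfold bM
  rw [if_neg hk', symmAlias_eq_aliasPt]
  exact bMajA_alias_le hs hk μ

/-- **`‖q_k‖²·bM_k² ≤ (CBa/π)²·W(j_k)²`** for `k ≠ 0`. [folklore] -/
theorem sq_mul_bM_sq_le (hN : 1 ≤ N) (a : ℝ) {s : Fin d → ℝ} (hs : ∀ ν, |s ν| ≤ Real.pi) (μ : Fin d)
    {k : Fin d → Fin N} (hk : jOf N k s ≠ 0) :
    ‖symmAlias N k s‖ ^ 2 * bM N a s μ k ^ 2 ≤ (CBa d / Real.pi) ^ 2 * aliasWeight s (jOf N k s) ^ 2 := by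
  have hπ := Real.pi_pos
  have hk' : k ≠ 0 := fun h => hk ((jOf_eq_zero_iff hN hs k).mpr h)
  set j := jOf N k s with hj
  have hq : symmAlias N k s = aliasPt s j := by rw [symmAlias_eq_aliasPt]
  have hx : Real.pi ≤ ‖aliasPt s j‖ := pi_le_norm_aliasPt hs hk
  have hx0 : 0 < ‖aliasPt s j‖ := lt_of_lt_of_le hπ hx
  have hw := aliasWeight_nonneg s j
  have hC := CBa_nonneg d
  have h1 : bM N a s μ k ≤ CBa d * aliasWeight s j / ‖aliasPt s j‖ ^ 2 := by
    have := bM_le_W_div_sq hN a hs μ hk; rwa [hq] at this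
  have h0 : 0 ≤ bM N a s μ k := by unfold bM; rw [if_neg hk']; exact bMajA_nonneg _ _ _
  have h2 := pow_le_pow_left₀ h0 h1 2
  rw [hq]
  calc ‖aliasPt s j‖ ^ 2 * bM N a s μ k ^ 2
      ≤ ‖aliasPt s j‖ ^ 2 * (CBa d * aliasWeight s j / ‖aliasPt s j‖ ^ 2) ^ 2 :=
        mul_le_mul_of_nonneg_left h2 (sq_nonneg _)
    _ = (CBa d * aliasWeight s j) ^ 2 / ‖aliasPt s j‖ ^ 2 := by field_simp
    _ ≤ (CBa d * aliasWeight s j) ^ 2 / Real.pi ^ 2 := by gcongr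
    _ = (CBa d / Real.pi) ^ 2 * aliasWeight s j ^ 2 := by field_simp

/-- **`‖q_k‖²·(be_k·bM_k)² ≤ ((Ab·d + Bb)·CBa/N)²·W(j_k)²`** for `k ≠ 0`
(`B5G183RateSum.be_bM_le_aliasTerm`). [folklore] -/
theorem sq_mul_be_bM_sq_le (hN : 1 ≤ N) (a : ℝ) (ha : 0 < a) {s : Fin d → ℝ} (hs : ∀ ν, |s ν| ≤ Real.pi)
    (ν₀ : Fin d) (hν₀ : s ν₀ ≠ 0) (μ : Fin d) {k : Fin d → Fin N} (hk : jOf N k s ≠ 0) :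
    ‖symmAlias N k s‖ ^ 2 * (be N a s k * bM N a s μ k) ^ 2
      ≤ ((B5G183Rate.Ab d * d + Bb d) * CBa d / N) ^ 2 * aliasWeight s (jOf N k s) ^ 2 := by
  have hπ := Real.pi_pos
  have hN0 : (0 : ℝ) < N := by exact_mod_cast hN
  set j := jOf N k s with hj
  have hq : symmAlias N k s = aliasPt s j := by rw [symmAlias_eq_aliasPt]
  have hx0 : 0 < ‖aliasPt s j‖ := lt_of_lt_of_le hπ (pi_le_norm_aliasPt hs hk)
  have hw := aliasWeight_nonneg s j
  have h1 : be N a s k * bM N a s μ k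
      ≤ (B5G183Rate.Ab d * d + Bb d) * CBa d / N * (‖aliasPt s j‖⁻¹ * aliasWeight s j) := by
    have h := be_bM_le_aliasTerm hN a hs μ hk
    unfold King1986.aliasTerm at h
    rwa [zero_sub, Real.rpow_neg_one] at h
  have h0 : 0 ≤ be N a s k * bM N a s μ k := mul_nonneg (be_nonneg ha hs ν₀ hν₀ k) (bM_nonneg ha s μ k)
  have h2 := pow_le_pow_left₀ h0 h1 2
  rw [hq]
  calc ‖aliasPt s j‖ ^ 2 * (be N a s k * bM N a s μ k) ^ 2
      ≤ ‖aliasPt s j‖ ^ 2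
          * ((B5G183Rate.Ab d * d + Bb d) * CBa d / N * (‖aliasPt s j‖⁻¹ * aliasWeight s j)) ^ 2 :=
        mul_le_mul_of_nonneg_left h2 (sq_nonneg _)
    _ = ((B5G183Rate.Ab d * d + Bb d) * CBa d / N) ^ 2 * aliasWeight s j ^ 2 := by field_simp

/-- **UNPAIRED level-`RN` bracket classes: `‖q″‖²·bM_{k″}² ≤ (CBa/(πN))²·W(j″)²`.** [folklore] -/
theorem sq_mul_bM_sq_unpaired_le (hN : 1 ≤ N) (hR : 1 ≤ R) (a : ℝ) {s : Fin d → ℝ}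
    (hs : ∀ ν, |s ν| ≤ Real.pi) (μ : Fin d) {k'' : Fin d → Fin (R * N)}
    (hu : ∀ k : Fin d → Fin N, iota R k s ≠ k'') :
    ‖symmAlias (R * N) k'' s‖ ^ 2 * bM (R * N) a s μ k'' ^ 2
      ≤ (CBa d / (Real.pi * N)) ^ 2 * aliasWeight s (jOf (R * N) k'' s) ^ 2 := by
  have hπ := Real.pi_pos
  have hN0 : (0 : ℝ) < N := by exact_mod_cast hN
  have hRN : 1 ≤ R * N := one_le_RN hN hR
  have hj0 := jOf_ne_zero_of_unpaired hN hs hu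
  have hk0 : k'' ≠ 0 := fun h => hj0 ((jOf_eq_zero_iff hRN hs k'').mpr h)
  set j := jOf (R * N) k'' s with hj
  have hq : symmAlias (R * N) k'' s = aliasPt s j := by rw [symmAlias_eq_aliasPt]
  have hfar : Real.pi * N ≤ ‖aliasPt s j‖ := by rw [← hq]; exact norm_ge_of_unpaired hN hs hu
  have hx0 : 0 < ‖aliasPt s j‖ := lt_of_lt_of_le (by positivity) hfar
  have hw := aliasWeight_nonneg s j
  have hC := CBa_nonneg d
  have h1 : bM (R * N) a s μ k'' ≤ CBa d * aliasWeight s j / ‖aliasPt s j‖ ^ 2 := by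
    have := bM_le_W_div_sq hRN a hs μ hj0; rwa [hq] at this
  have h0 : 0 ≤ bM (R * N) a s μ k'' := by unfold bM; rw [if_neg hk0]; exact bMajA_nonneg _ _ _
  have h2 := pow_le_pow_left₀ h0 h1 2
  rw [hq]
  calc ‖aliasPt s j‖ ^ 2 * bM (R * N) a s μ k'' ^ 2
      ≤ ‖aliasPt s j‖ ^ 2 * (CBa d * aliasWeight s j / ‖aliasPt s j‖ ^ 2) ^ 2 :=
        mul_le_mul_of_nonneg_left h2 (sq_nonneg _)
    _ = (CBa d * aliasWeight s j) ^ 2 / ‖aliasPt s j‖ ^ 2 := by field_simp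
    _ ≤ (CBa d * aliasWeight s j) ^ 2 / (Real.pi * N) ^ 2 := by gcongr
    _ = (CBa d / (Real.pi * N)) ^ 2 * aliasWeight s j ^ 2 := by field_simp

end PerClass

/-! ## §2 The `ℓ²` sums over the classes (King (4.22) at `s = 2`: no momentum power is spent, so one
power of `‖q‖` per vector is free and the η-rate keeps the full `1/N`) -/

section Sums

variable {N R : ℕ} [NeZero N] [NeZero R]

/-- **`Σ_{k ≠ 0} ‖q_k‖²·xM_k² ≤ (CXa/π)²·CW`.** [cite: King1986, (4.22) p.672] [folklore] -/
theorem sum_sq_xM_sq_le (hN : 1 ≤ N) {s : Fin d → ℝ} (hs : ∀ ν, |s ν| ≤ Real.pi) (μ : Fin d) :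
    ∑ k ∈ Finset.univ.erase (0 : Fin d → Fin N), ‖symmAlias N k s‖ ^ 2 * xM N s μ k ^ 2
      ≤ (CXa d / Real.pi) ^ 2 * CW d := by
  refine sum_le_of_aliasSq_bound hs _ _ (sq_nonneg _) (fun k hk => ?_) (fun k hk => sq_mul_xM_sq_le hs μ ?_)
  all_goals exact fun h0 => (Finset.ne_of_mem_erase hk) ((jOf_eq_zero_iff hN hs k).mp h0)

/-- **`Σ_{k ≠ 0} ‖q_k‖⁴·xM_k² ≤ CXa²·CW`** (two powers, still uniformly bounded). [folklore] -/
theorem sum_pow_four_xM_sq_le (hN : 1 ≤ N) {s : Fin d → ℝ} (hs : ∀ ν, |s ν| ≤ Real.pi) (μ : Fin d) :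
    ∑ k ∈ Finset.univ.erase (0 : Fin d → Fin N), ‖symmAlias N k s‖ ^ 4 * xM N s μ k ^ 2
      ≤ CXa d ^ 2 * CW d := by
  refine sum_le_of_aliasSq_bound hs _ _ (sq_nonneg _) (fun k hk => ?_)
    (fun k hk => pow_four_mul_xM_sq_le hs μ ?_)
  all_goals exact fun h0 => (Finset.ne_of_mem_erase hk) ((jOf_eq_zero_iff hN hs k).mp h0)

/-- **`Σ_{k ≠ 0} ‖q_k‖²·(xe_k·xM_k)² ≤ (Ax·d·CXa/N)²·CW`** — the η-rate of the order-one x-vector in `ℓ²`,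
squared: `O(N⁻²)` with NO loss. [cite: King1986, (4.22)–(4.24) p.672, (4.29)/(4.31) p.673] [folklore] -/
theorem sum_sq_xe_xM_sq_le (hN : 1 ≤ N) {s : Fin d → ℝ} (hs : ∀ ν, |s ν| ≤ Real.pi) (μ : Fin d) :
    ∑ k ∈ Finset.univ.erase (0 : Fin d → Fin N), ‖symmAlias N k s‖ ^ 2 * (xe N s k * xM N s μ k) ^ 2
      ≤ (Ax d * d * CXa d / N) ^ 2 * CW d := by
  refine sum_le_of_aliasSq_bound hs _ _ (sq_nonneg _) (fun k hk => ?_)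
    (fun k hk => sq_mul_xe_xM_sq_le hN hs μ ?_)
  all_goals exact fun h0 => (Finset.ne_of_mem_erase hk) ((jOf_eq_zero_iff hN hs k).mp h0)

/-- **UNPAIRED level-`RN` classes: `Σ_{k″ unpaired} ‖q″‖²·xM_{k″}² ≤ (CXa/(πN))²·CW`** (`O(N⁻²)`).
[cite: King1986, (4.23) p.672] [folklore] -/
theorem sum_sq_xM_sq_unpaired_le (hN : 1 ≤ N) {s : Fin d → ℝ} (hs : ∀ ν, |s ν| ≤ Real.pi) (μ : Fin d) :
    ∑ k'' ∈ Finset.univ.filter (fun k'' => ∀ k : Fin d → Fin N, iota R k s ≠ k''),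
        ‖symmAlias (R * N) k'' s‖ ^ 2 * xM (R * N) s μ k'' ^ 2
      ≤ (CXa d / (Real.pi * N)) ^ 2 * CW d := by
  classical
  refine sum_le_of_aliasSq_bound hs _ _ (sq_nonneg _) (fun k'' hk'' => ?_) (fun k'' hk'' => ?_)
  · simp only [Finset.mem_filter, Finset.mem_univ, true_and] at hk''
    exact jOf_ne_zero_of_unpaired hN hs hk''
  · simp only [Finset.mem_filter, Finset.mem_univ, true_and] at hk''
    exact sq_mul_xM_sq_unpaired_le hN hs μ hk''

/-- **`Σ_{k ≠ 0} ‖q_k‖²·bM_k² ≤ (CBa/π)²·CW`.** [folklore] -/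
theorem sum_sq_bM_sq_le (hN : 1 ≤ N) (a : ℝ) {s : Fin d → ℝ} (hs : ∀ ν, |s ν| ≤ Real.pi) (μ : Fin d) :
    ∑ k ∈ Finset.univ.erase (0 : Fin d → Fin N), ‖symmAlias N k s‖ ^ 2 * bM N a s μ k ^ 2
      ≤ (CBa d / Real.pi) ^ 2 * CW d := by
  refine sum_le_of_aliasSq_bound hs _ _ (sq_nonneg _) (fun k hk => ?_)
    (fun k hk => sq_mul_bM_sq_le hN a hs μ ?_)
  all_goals exact fun h0 => (Finset.ne_of_mem_erase hk) ((jOf_eq_zero_iff hN hs k).mp h0)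

/-- **`Σ_{k ≠ 0} ‖q_k‖²·(be_k·bM_k)² ≤ ((Ab·d + Bb)·CBa/N)²·CW`** (`O(N⁻²)`). [folklore] -/
theorem sum_sq_be_bM_sq_le (hN : 1 ≤ N) (a : ℝ) (ha : 0 < a) {s : Fin d → ℝ} (hs : ∀ ν, |s ν| ≤ Real.pi)
    (ν₀ : Fin d) (hν₀ : s ν₀ ≠ 0) (μ : Fin d) :
    ∑ k ∈ Finset.univ.erase (0 : Fin d → Fin N), ‖symmAlias N k s‖ ^ 2 * (be N a s k * bM N a s μ k) ^ 2
      ≤ ((B5G183Rate.Ab d * d + Bb d) * CBa d / N) ^ 2 * CW d := by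
  refine sum_le_of_aliasSq_bound hs _ _ (sq_nonneg _) (fun k hk => ?_)
    (fun k hk => sq_mul_be_bM_sq_le hN a ha hs ν₀ hν₀ μ ?_)
  all_goals exact fun h0 => (Finset.ne_of_mem_erase hk) ((jOf_eq_zero_iff hN hs k).mp h0)

/-- **UNPAIRED level-`RN` bracket classes: `Σ ‖q″‖²·bM_{k″}² ≤ (CBa/(πN))²·CW`.** [folklore] -/
theorem sum_sq_bM_sq_unpaired_le (hN : 1 ≤ N) (hR : 1 ≤ R) (a : ℝ) {s : Fin d → ℝ}
    (hs : ∀ ν, |s ν| ≤ Real.pi) (μ : Fin d) :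
    ∑ k'' ∈ Finset.univ.filter (fun k'' => ∀ k : Fin d → Fin N, iota R k s ≠ k''),
        ‖symmAlias (R * N) k'' s‖ ^ 2 * bM (R * N) a s μ k'' ^ 2
      ≤ (CBa d / (Real.pi * N)) ^ 2 * CW d := by
  classical
  refine sum_le_of_aliasSq_bound hs _ _ (sq_nonneg _) (fun k'' hk'' => ?_) (fun k'' hk'' => ?_)
  · simp only [Finset.mem_filter, Finset.mem_univ, true_and] at hk''
    exact jOf_ne_zero_of_unpaired hN hs hk''
  · simp only [Finset.mem_filter, Finset.mem_univ, true_and] at hk''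
    exact sq_mul_bM_sq_unpaired_le hN hR a hs μ hk''

/-- the CENTRE class of the bracket vector: `‖p′‖²·bM_0² ≤ π²·(π·MrS)²` (`bM_0 = |p′_μ|·MrS`, (1.88) form).
[cite: Balaban1984PropagatorsI, (1.88) p.32] [folklore] -/
theorem center_sq_bM_sq_le (hN : 1 ≤ N) {a : ℝ} (ha : 0 < a) {s : Fin d → ℝ} (hs : ∀ ν, |s ν| ≤ Real.pi)
    (μ : Fin d) :
    ‖symmAlias N (0 : Fin d → Fin N) s‖ ^ 2 * bM N a s μ 0 ^ 2 ≤ Real.pi ^ 2 * (Real.pi * MrS d a) ^ 2 := by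
  have hπ := Real.pi_pos
  have hM := MrS_pos d ha
  have h1 : ‖symmAlias N (0 : Fin d → Fin N) s‖ ≤ Real.pi := by rw [symmAlias_zero hN hs]; exact norm_le_pi hs
  have h2 : bM N a s μ 0 ≤ Real.pi * MrS d a := by
    unfold bM; rw [if_pos rfl]; exact mul_le_mul_of_nonneg_right (hs μ) hM.le
  have h0 : 0 ≤ bM N a s μ 0 := bM_nonneg ha s μ 0
  exact mul_le_mul (pow_le_pow_left₀ (norm_nonneg _) h1 2) (pow_le_pow_left₀ h0 h2 2) (sq_nonneg _)
    (by positivity)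

/-- the CENTRE class, η-rate: `‖p′‖²·(be_0·bM_0)² ≤ π²·(SBe/N)²` (`be_0·bM_0 ≤ Σ_k be·bM ≤ SBe/N`).
[folklore] -/
theorem center_sq_be_bM_sq_le (hN : 1 ≤ N) (a : ℝ) (ha : 0 < a) {s : Fin d → ℝ} (hs : ∀ ν, |s ν| ≤ Real.pi)
    (ν₀ : Fin d) (hν₀ : s ν₀ ≠ 0) (μ : Fin d) :
    ‖symmAlias N (0 : Fin d → Fin N) s‖ ^ 2 * (be N a s 0 * bM N a s μ 0) ^ 2
      ≤ Real.pi ^ 2 * (SBe d a / N) ^ 2 := by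
  have hπ := Real.pi_pos
  have h1 : ‖symmAlias N (0 : Fin d → Fin N) s‖ ≤ Real.pi := by rw [symmAlias_zero hN hs]; exact norm_le_pi hs
  have h0 : ∀ k, 0 ≤ be N a s k * bM N a s μ k := fun k =>
    mul_nonneg (be_nonneg ha hs ν₀ hν₀ k) (bM_nonneg ha s μ k)
  have h2 : be N a s 0 * bM N a s μ 0 ≤ SBe d a / N :=
    (Finset.single_le_sum (f := fun k => be N a s k * bM N a s μ k) (fun k _ => h0 k)
      (Finset.mem_univ 0)).trans (sum_be_bM_le hN a ha hs ν₀ hν₀ μ)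
  exact mul_le_mul (pow_le_pow_left₀ (norm_nonneg _) h1 2) (pow_le_pow_left₀ (h0 0) h2 2) (sq_nonneg _)
    (by positivity)

end Sums

/-! ## §3 The ORDER-ONE WEIGHTED alias vectors of (1.83): uniform `ℓ²` bounds and the `ℓ²` η-rate `O(1/N)`

The finite-rank part of the fibre of (1.83) is `−Σ_μ cX·x_μ x_μ^* + cB·b b^*` with the vectors
`x_μ(k) = xP_μ(q_k)` (classes `k ≠ 0`; the corner `(0,0)` is (1.87)'s `dZ`) and `b(k,μ) = bR_μ(q_k)` (all
classes).  A derivative sandwich of order one multiplies them by a weight `w(k)` with `|w(k)| ≤ ‖q_k‖`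
(`|∂^{(n)}_ν(q)| = 2n|sin(q_ν/2n)| ≤ |q_ν| ≤ ‖q‖_∞`) whose own η-rate between paired classes is
`|w^{(RN)}(ιk) − w^{(N)}(k)| ≤ c_w‖q_k‖²/N`; both are HYPOTHESES here (abstract weights). -/

section Vectors

variable {N R : ℕ} [NeZero N] [NeZero R]

omit [NeZero R] in
/-- **uniform `ℓ²` bound of the weighted x-vector (classes `k ≠ 0`)**:
`Σ_{k≠0} |w(k)·xP^{(N)}_μ(q_k)|² ≤ (CXa/π)²·CW` for any weight `|w(k)| ≤ ‖q_k‖`.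
[cite: Balaban1984PropagatorsI, (1.83) p.31, Prop. 1.1 (1.89) p.33] [folklore] -/
theorem xVec_sq_le (hN : 1 ≤ N) {s : Fin d → ℝ} (hs : ∀ ν, |s ν| ≤ Real.pi) (ν₀ : Fin d) (hν₀ : s ν₀ ≠ 0)
    (μ : Fin d) {w : (Fin d → Fin N) → ℂ} (hw : ∀ k, ‖w k‖ ≤ ‖symmAlias N k s‖) :
    ∑ k ∈ Finset.univ.erase (0 : Fin d → Fin N), ‖w k * xP N μ (symmAlias N k s)‖ ^ 2
      ≤ (CXa d / Real.pi) ^ 2 * CW d := by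
  refine (Finset.sum_le_sum fun k _ => ?_).trans (sum_sq_xM_sq_le hN hs μ)
  rw [norm_mul, mul_pow]
  exact mul_le_mul (pow_le_pow_left₀ (norm_nonneg _) (hw k) 2)
    (pow_le_pow_left₀ (norm_nonneg _) (norm_xP_le_xM hN le_rfl hN hs ν₀ hν₀ μ k) 2) (sq_nonneg _)
    (sq_nonneg _)

/-- **the UNPAIRED tail at level `RN`**: `Σ_{k″ unpaired} |w(k″)·xP^{(RN)}_μ(q″)|² ≤ (CXa/(πN))²·CW` — the
level-`RN` modes with no level-`N` partner carry `O(N⁻²)` of the squared `ℓ²` mass even with one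
derivative. [cite: King1986, (4.23) p.672] [folklore] -/
theorem xVec_unpaired_sq_le (hN : 1 ≤ N) (hR : 1 ≤ R) {s : Fin d → ℝ} (hs : ∀ ν, |s ν| ≤ Real.pi)
    (ν₀ : Fin d) (hν₀ : s ν₀ ≠ 0) (μ : Fin d) {w : (Fin d → Fin (R * N)) → ℂ}
    (hw : ∀ k'', ‖w k''‖ ≤ ‖symmAlias (R * N) k'' s‖) :
    ∑ k'' ∈ Finset.univ.filter (fun k'' => ∀ k : Fin d → Fin N, iota R k s ≠ k''),
        ‖w k'' * xP (R * N) μ (symmAlias (R * N) k'' s)‖ ^ 2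
      ≤ (CXa d / (Real.pi * N)) ^ 2 * CW d := by
  have hRN : 1 ≤ R * N := one_le_RN hN hR
  refine (Finset.sum_le_sum fun k'' _ => ?_).trans (sum_sq_xM_sq_unpaired_le (R := R) hN hs μ)
  rw [norm_mul, mul_pow]
  exact mul_le_mul (pow_le_pow_left₀ (norm_nonneg _) (hw k'') 2)
    (pow_le_pow_left₀ (norm_nonneg _) (norm_xP_le_xM hRN le_rfl hRN hs ν₀ hν₀ μ k'') 2) (sq_nonneg _)
    (sq_nonneg _)

/-- **the `ℓ²` η-RATE of the weighted x-vector, squared, is `O(N⁻²)`**: for weights `|w^{(N)}(k)| ≤ ‖q_k‖`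
whose paired η-rate is `|w^{(RN)}(ιk) − w^{(N)}(k)| ≤ c_w‖q_k‖²/N`,
`Σ_{k≠0} |w^{(N)}(k)·xP^{(N)}_μ(q_k) − w^{(RN)}(ιk)·xP^{(RN)}_μ(q_k)|² ≤ 2((Ax·d·CXa)² + (c_w·CXa)²)·CW/N²`
— the full η-currency `1/N`, no loss: the squared alias weight is summable with two momentum powers to
spare. [cite: King1986, (4.19)–(4.24) p.672, (4.29)–(4.31) p.673; Balaban1984PropagatorsI, (1.83) p.31]
[folklore] -/
theorem xVec_rate_sq_le (hN : 1 ≤ N) (hR : 1 ≤ R) {s : Fin d → ℝ} (hs : ∀ ν, |s ν| ≤ Real.pi)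
    (ν₀ : Fin d) (hν₀ : s ν₀ ≠ 0) (μ : Fin d) {wN : (Fin d → Fin N) → ℂ}
    {wR : (Fin d → Fin (R * N)) → ℂ} {cw : ℝ} (hcw : 0 ≤ cw)
    (hwN : ∀ k, ‖wN k‖ ≤ ‖symmAlias N k s‖)
    (hδ : ∀ k, ‖wR (iota R k s) - wN k‖ ≤ cw * ‖symmAlias N k s‖ ^ 2 / N) :
    ∑ k ∈ Finset.univ.erase (0 : Fin d → Fin N),
        ‖wN k * xP N μ (symmAlias N k s) - wR (iota R k s) * xP (R * N) μ (symmAlias N k s)‖ ^ 2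
      ≤ 2 * ((Ax d * d * CXa d) ^ 2 + (cw * CXa d) ^ 2) * CW d / (N : ℝ) ^ 2 := by
  have hN0 : (0 : ℝ) < N := by exact_mod_cast hN
  have hRN : 1 ≤ R * N := one_le_RN hN hR
  have hNm : N ≤ R * N := Nat.le_mul_of_pos_left N (by omega)
  have hper : ∀ k ∈ Finset.univ.erase (0 : Fin d → Fin N),
      ‖wN k * xP N μ (symmAlias N k s) - wR (iota R k s) * xP (R * N) μ (symmAlias N k s)‖ ^ 2
        ≤ 2 * (‖symmAlias N k s‖ ^ 2 * (xe N s k * xM N s μ k) ^ 2)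
          + 2 * (cw / N) ^ 2 * (‖symmAlias N k s‖ ^ 4 * xM N s μ k ^ 2) := by
    intro k _
    set q := symmAlias N k s with hq
    have hxM := xM_nonneg s μ k
    have e : wN k * xP N μ q - wR (iota R k s) * xP (R * N) μ q
        = wN k * (xP N μ q - xP (R * N) μ q) - (wR (iota R k s) - wN k) * xP (R * N) μ q := by ring
    have h1 : ‖wN k * (xP N μ q - xP (R * N) μ q)‖ ≤ ‖q‖ * (xe N s k * xM N s μ k) := by
      rw [norm_mul]
      exact mul_le_mul (hwN k) (xP_rate_le hN hR hs ν₀ hν₀ μ k) (norm_nonneg _) (norm_nonneg _)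
    have h2 : ‖(wR (iota R k s) - wN k) * xP (R * N) μ q‖ ≤ cw * ‖q‖ ^ 2 / N * xM N s μ k := by
      rw [norm_mul]
      exact mul_le_mul (hδ k) (norm_xP_le_xM hRN hNm hN hs ν₀ hν₀ μ k) (norm_nonneg _) (by positivity)
    have h3 : ‖wN k * xP N μ q - wR (iota R k s) * xP (R * N) μ q‖
        ≤ ‖q‖ * (xe N s k * xM N s μ k) + cw * ‖q‖ ^ 2 / N * xM N s μ k := by
      rw [e]; exact (norm_sub_le _ _).trans (add_le_add h1 h2)
    have h4 := pow_le_pow_left₀ (norm_nonneg _) h3 2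
    have h5 : ∀ u v : ℝ, (u + v) ^ 2 ≤ 2 * u ^ 2 + 2 * v ^ 2 := fun u v => by
      nlinarith [sq_nonneg (u - v)]
    refine h4.trans ((h5 _ _).trans_eq ?_)
    field_simp
  refine (Finset.sum_le_sum hper).trans ?_
  rw [Finset.sum_add_distrib, ← Finset.mul_sum, ← Finset.mul_sum]
  have hA := sum_sq_xe_xM_sq_le hN hs μ
  have hB := sum_pow_four_xM_sq_le hN hs μ
  have hW := CW_nonneg d
  calc 2 * ∑ k ∈ Finset.univ.erase (0 : Fin d → Fin N), ‖symmAlias N k s‖ ^ 2 * (xe N s k * xM N s μ k) ^ 2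
        + 2 * (cw / N) ^ 2 * ∑ k ∈ Finset.univ.erase (0 : Fin d → Fin N),
            ‖symmAlias N k s‖ ^ 4 * xM N s μ k ^ 2
      ≤ 2 * ((Ax d * d * CXa d / N) ^ 2 * CW d) + 2 * (cw / N) ^ 2 * (CXa d ^ 2 * CW d) := by
        gcongr
    _ = 2 * ((Ax d * d * CXa d) ^ 2 + (cw * CXa d) ^ 2) * CW d / (N : ℝ) ^ 2 := by
        field_simp

/-- **uniform `ℓ²` bound of the weighted bracket vector (ALL classes, centre included)**:
`Σ_k |w(k)·bR^{(N)}_μ(q_k)|² ≤ π²(π·MrS)² + (CBa/π)²·CW`. [cite: Balaban1984PropagatorsI, (1.83) p.31,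
(1.88) p.32] [folklore] -/
theorem bVec_sq_le (hN : 1 ≤ N) (a : ℝ) (ha : 0 < a) {s : Fin d → ℝ} (hs : ∀ ν, |s ν| ≤ Real.pi)
    (ν₀ : Fin d) (hν₀ : s ν₀ ≠ 0) (μ : Fin d) {w : (Fin d → Fin N) → ℂ}
    (hw : ∀ k, ‖w k‖ ≤ ‖symmAlias N k s‖) :
    ∑ k : Fin d → Fin N, ‖w k * bR N a μ (symmAlias N k s) s‖ ^ 2
      ≤ Real.pi ^ 2 * (Real.pi * MrS d a) ^ 2 + (CBa d / Real.pi) ^ 2 * CW d := by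
  have hper : ∀ k : Fin d → Fin N,
      ‖w k * bR N a μ (symmAlias N k s) s‖ ^ 2 ≤ ‖symmAlias N k s‖ ^ 2 * bM N a s μ k ^ 2 := by
    intro k
    rw [norm_mul, mul_pow]
    exact mul_le_mul (pow_le_pow_left₀ (norm_nonneg _) (hw k) 2)
      (pow_le_pow_left₀ (norm_nonneg _) (norm_bR_le_bM hN le_rfl hN a ha hs ν₀ hν₀ μ k) 2) (sq_nonneg _)
      (sq_nonneg _)
  refine (Finset.sum_le_sum fun k _ => hper k).trans ?_
  rw [← Finset.add_sum_erase _ _ (Finset.mem_univ (0 : Fin d → Fin N))]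
  exact add_le_add (center_sq_bM_sq_le hN ha hs μ) (sum_sq_bM_sq_le hN a hs μ)

/-- **the UNPAIRED bracket tail at level `RN`**: `Σ_{k″ unpaired} |w(k″)·bR^{(RN)}_μ(q″)|² ≤ (CBa/(πN))²·CW`.
[cite: King1986, (4.23) p.672] [folklore] -/
theorem bVec_unpaired_sq_le (hN : 1 ≤ N) (hR : 1 ≤ R) (a : ℝ) (ha : 0 < a) {s : Fin d → ℝ}
    (hs : ∀ ν, |s ν| ≤ Real.pi) (ν₀ : Fin d) (hν₀ : s ν₀ ≠ 0) (μ : Fin d)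
    {w : (Fin d → Fin (R * N)) → ℂ} (hw : ∀ k'', ‖w k''‖ ≤ ‖symmAlias (R * N) k'' s‖) :
    ∑ k'' ∈ Finset.univ.filter (fun k'' => ∀ k : Fin d → Fin N, iota R k s ≠ k''),
        ‖w k'' * bR (R * N) a μ (symmAlias (R * N) k'' s) s‖ ^ 2
      ≤ (CBa d / (Real.pi * N)) ^ 2 * CW d := by
  have hRN : 1 ≤ R * N := one_le_RN hN hR
  refine (Finset.sum_le_sum fun k'' _ => ?_).trans (sum_sq_bM_sq_unpaired_le hN hR a hs μ)
  rw [norm_mul, mul_pow]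
  exact mul_le_mul (pow_le_pow_left₀ (norm_nonneg _) (hw k'') 2)
    (pow_le_pow_left₀ (norm_nonneg _) (norm_bR_le_bM hRN le_rfl hRN a ha hs ν₀ hν₀ μ k'') 2)
    (sq_nonneg _) (sq_nonneg _)

/-- the rate constant of the bracket vector (times `N⁻²`). [folklore] -/
def CbRate (d : ℕ) (a cw : ℝ) : ℝ :=
  2 * (Real.pi ^ 2 * SBe d a ^ 2 + (cw * Real.pi ^ 2) ^ 2 * (Real.pi * MrS d a) ^ 2)
    + 2 * (((B5G183Rate.Ab d * d + Bb d) * CBa d) ^ 2 + (cw * CBa d) ^ 2) * CW d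

/-- **the `ℓ²` η-RATE of the weighted bracket vector, squared, is `O(N⁻²)`** (ALL classes):
`Σ_k |w^{(N)}(k)·bR^{(N)}_μ(q_k) − w^{(RN)}(ιk)·bR^{(RN)}_μ(q_k)|² ≤ CbRate(d,a,c_w)/N²`.
[cite: King1986, (4.19)–(4.24) p.672, (4.29)–(4.31) p.673; Balaban1984PropagatorsI, (1.83) p.31, (1.88)
p.32] [folklore] -/
theorem bVec_rate_sq_le (hN : 1 ≤ N) (hR : 1 ≤ R) (a : ℝ) (ha : 0 < a) {s : Fin d → ℝ}
    (hs : ∀ ν, |s ν| ≤ Real.pi) (ν₀ : Fin d) (hν₀ : s ν₀ ≠ 0) (μ : Fin d) {wN : (Fin d → Fin N) → ℂ}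
    {wR : (Fin d → Fin (R * N)) → ℂ} {cw : ℝ} (hcw : 0 ≤ cw)
    (hwN : ∀ k, ‖wN k‖ ≤ ‖symmAlias N k s‖)
    (hδ : ∀ k, ‖wR (iota R k s) - wN k‖ ≤ cw * ‖symmAlias N k s‖ ^ 2 / N) :
    ∑ k : Fin d → Fin N,
        ‖wN k * bR N a μ (symmAlias N k s) s - wR (iota R k s) * bR (R * N) a μ (symmAlias N k s) s‖ ^ 2
      ≤ CbRate d a cw / (N : ℝ) ^ 2 := by
  have hN0 : (0 : ℝ) < N := by exact_mod_cast hN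
  have hπ := Real.pi_pos
  have hRN : 1 ≤ R * N := one_le_RN hN hR
  have hNm : N ≤ R * N := Nat.le_mul_of_pos_left N (by omega)
  have hper : ∀ k : Fin d → Fin N,
      ‖wN k * bR N a μ (symmAlias N k s) s - wR (iota R k s) * bR (R * N) a μ (symmAlias N k s) s‖ ^ 2
        ≤ 2 * (‖symmAlias N k s‖ ^ 2 * (be N a s k * bM N a s μ k) ^ 2)
          + 2 * (cw / N) ^ 2 * (‖symmAlias N k s‖ ^ 4 * bM N a s μ k ^ 2) := by
    intro k
    set q := symmAlias N k s with hq
    have hbM := bM_nonneg (N := N) ha s μ k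
    have e : wN k * bR N a μ q s - wR (iota R k s) * bR (R * N) a μ q s
        = wN k * (bR N a μ q s - bR (R * N) a μ q s) - (wR (iota R k s) - wN k) * bR (R * N) a μ q s := by
      ring
    have h1 : ‖wN k * (bR N a μ q s - bR (R * N) a μ q s)‖ ≤ ‖q‖ * (be N a s k * bM N a s μ k) := by
      rw [norm_mul]
      exact mul_le_mul (hwN k) (bR_rate_le hN hR a ha hs ν₀ hν₀ μ k) (norm_nonneg _) (norm_nonneg _)
    have h2 : ‖(wR (iota R k s) - wN k) * bR (R * N) a μ q s‖ ≤ cw * ‖q‖ ^ 2 / N * bM N a s μ k := by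
      rw [norm_mul]
      exact mul_le_mul (hδ k) (norm_bR_le_bM hRN hNm hN a ha hs ν₀ hν₀ μ k) (norm_nonneg _)
        (by positivity)
    have h3 : ‖wN k * bR N a μ q s - wR (iota R k s) * bR (R * N) a μ q s‖
        ≤ ‖q‖ * (be N a s k * bM N a s μ k) + cw * ‖q‖ ^ 2 / N * bM N a s μ k := by
      rw [e]; exact (norm_sub_le _ _).trans (add_le_add h1 h2)
    have h4 := pow_le_pow_left₀ (norm_nonneg _) h3 2
    have h5 : ∀ u v : ℝ, (u + v) ^ 2 ≤ 2 * u ^ 2 + 2 * v ^ 2 := fun u v => by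
      nlinarith [sq_nonneg (u - v)]
    refine h4.trans ((h5 _ _).trans_eq ?_)
    field_simp
  refine (Finset.sum_le_sum fun k _ => hper k).trans ?_
  rw [Finset.sum_add_distrib, ← Finset.mul_sum, ← Finset.mul_sum,
    ← Finset.add_sum_erase _ _ (Finset.mem_univ (0 : Fin d → Fin N)),
    ← Finset.add_sum_erase _ (fun k => ‖symmAlias N k s‖ ^ 4 * bM N a s μ k ^ 2)
      (Finset.mem_univ (0 : Fin d → Fin N))]
  have hA0 := center_sq_be_bM_sq_le hN a ha hs ν₀ hν₀ μ
  have hA := sum_sq_be_bM_sq_le hN a ha hs ν₀ hν₀ μ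
  have hB := sum_sq_bM_sq_le hN a hs μ
  have hW := CW_nonneg d
  have hM := MrS_pos d ha
  -- centre term with two powers: ‖p′‖⁴·bM_0² ≤ π²·(π²(πMrS)²)
  have hB0 : ‖symmAlias N (0 : Fin d → Fin N) s‖ ^ 4 * bM N a s μ 0 ^ 2
      ≤ Real.pi ^ 4 * (Real.pi * MrS d a) ^ 2 := by
    have h1 : ‖symmAlias N (0 : Fin d → Fin N) s‖ ≤ Real.pi := by
      rw [symmAlias_zero hN hs]; exact norm_le_pi hs
    have h2 : bM N a s μ 0 ≤ Real.pi * MrS d a := by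
      unfold bM; rw [if_pos rfl]; exact mul_le_mul_of_nonneg_right (hs μ) hM.le
    exact mul_le_mul (pow_le_pow_left₀ (norm_nonneg _) h1 4) (pow_le_pow_left₀ (bM_nonneg ha s μ 0) h2 2)
      (sq_nonneg _) (by positivity)
  -- the `k ≠ 0` sum with two powers: bM ≤ CBa W/‖q‖², so ‖q‖⁴ bM² ≤ CBa² W²
  have hB4 : ∑ k ∈ Finset.univ.erase (0 : Fin d → Fin N), ‖symmAlias N k s‖ ^ 4 * bM N a s μ k ^ 2
      ≤ CBa d ^ 2 * CW d := by
    refine sum_le_of_aliasSq_bound hs _ _ (sq_nonneg _) (fun k hk => ?_) (fun k hk => ?_)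
    · exact fun h0 => (Finset.ne_of_mem_erase hk) ((jOf_eq_zero_iff hN hs k).mp h0)
    · have hk0 : jOf N k s ≠ 0 := fun h0 => (Finset.ne_of_mem_erase hk) ((jOf_eq_zero_iff hN hs k).mp h0)
      have hk' : k ≠ 0 := Finset.ne_of_mem_erase hk
      set j := jOf N k s with hj
      have hq : symmAlias N k s = aliasPt s j := by rw [symmAlias_eq_aliasPt]
      have hx0 : 0 < ‖aliasPt s j‖ := lt_of_lt_of_le hπ (pi_le_norm_aliasPt hs hk0)
      have h1 : bM N a s μ k ≤ CBa d * aliasWeight s j / ‖aliasPt s j‖ ^ 2 := by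
        have := bM_le_W_div_sq hN a hs μ hk0; rwa [hq] at this
      have h0 : 0 ≤ bM N a s μ k := bM_nonneg ha s μ k
      have h2 := pow_le_pow_left₀ h0 h1 2
      rw [hq]
      calc ‖aliasPt s j‖ ^ 4 * bM N a s μ k ^ 2
          ≤ ‖aliasPt s j‖ ^ 4 * (CBa d * aliasWeight s j / ‖aliasPt s j‖ ^ 2) ^ 2 :=
            mul_le_mul_of_nonneg_left h2 (by positivity)
        _ = CBa d ^ 2 * aliasWeight s j ^ 2 := by field_simp
  calc 2 * (‖symmAlias N (0 : Fin d → Fin N) s‖ ^ 2 * (be N a s 0 * bM N a s μ 0) ^ 2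
          + ∑ k ∈ Finset.univ.erase (0 : Fin d → Fin N),
              ‖symmAlias N k s‖ ^ 2 * (be N a s k * bM N a s μ k) ^ 2)
        + 2 * (cw / N) ^ 2 * (‖symmAlias N (0 : Fin d → Fin N) s‖ ^ 4 * bM N a s μ 0 ^ 2
          + ∑ k ∈ Finset.univ.erase (0 : Fin d → Fin N), ‖symmAlias N k s‖ ^ 4 * bM N a s μ k ^ 2)
      ≤ 2 * (Real.pi ^ 2 * (SBe d a / N) ^ 2 + ((B5G183Rate.Ab d * d + Bb d) * CBa d / N) ^ 2 * CW d)
        + 2 * (cw / N) ^ 2 * (Real.pi ^ 4 * (Real.pi * MrS d a) ^ 2 + CBa d ^ 2 * CW d) := by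
        gcongr
    _ = CbRate d a cw / (N : ℝ) ^ 2 := by
        unfold CbRate
        field_simp
        ring

end Vectors

/-! ## §4 The INSTANCE: b05's order-one weight `w(k) = dSym n k p′ ν = ∂^{(n)}_ν(p′ + 2πk)` of the fibres
`D_{∂_ν}G(p′)`, `G(p′)D_{∂_ν}^*` of (1.89) (`B5Prop11Fiber.opNorm_D_G_le`, `opNorm_G_D_le`) satisfies the two
weight hypotheses of §3: `|∂^{(n)}_ν(q)| ≤ ‖q̃‖_∞` and `|∂^{(RN)}_ν(ιk) − ∂^{(N)}_ν(k)| ≤ 6‖q̃_k‖²/N`. -/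

section DSym

open Literature.MathematicalPhysics.QuantumFieldTheory.Balaban1983to89.B5Prop11Fiber

variable {N R : ℕ} [NeZero N] [NeZero R]

omit [NeZero N] [NeZero R] in
/-- the second-order Taylor remainder of `e^{it}` for ALL real `t`: `‖e^{it} − 1 − it‖ ≤ 3t²`
(`≤ t²` for `|t| ≤ 1` by Mathlib's `Complex.norm_exp_sub_one_sub_id_le`, `≤ 2 + |t| ≤ 3t²` beyond).
[folklore] -/
theorem norm_exp_mul_I_sub_one_sub_le (t : ℝ) :
    ‖Complex.exp ((t : ℂ) * I) - 1 - (t : ℂ) * I‖ ≤ 3 * t ^ 2 := by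
  have hn : ‖(t : ℂ) * I‖ = |t| := by
    rw [norm_mul, Complex.norm_real, Complex.norm_I, mul_one, Real.norm_eq_abs]
  have h3 : |t| ^ 2 = t ^ 2 := sq_abs t
  rcases le_or_gt |t| 1 with h | h
  · have := Complex.norm_exp_sub_one_sub_id_le (x := (t : ℂ) * I) (by rw [hn]; exact h)
    rw [hn, h3] at this
    nlinarith [sq_nonneg t]
  · have h1 : ‖Complex.exp ((t : ℂ) * I)‖ = 1 := Complex.norm_exp_ofReal_mul_I t
    have h2 : ‖Complex.exp ((t : ℂ) * I) - 1 - (t : ℂ) * I‖ ≤ 1 + 1 + |t| := by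
      calc ‖Complex.exp ((t : ℂ) * I) - 1 - (t : ℂ) * I‖
          ≤ ‖Complex.exp ((t : ℂ) * I) - 1‖ + ‖(t : ℂ) * I‖ := norm_sub_le _ _
        _ ≤ (‖Complex.exp ((t : ℂ) * I)‖ + ‖(1 : ℂ)‖) + ‖(t : ℂ) * I‖ := by
            gcongr; exact norm_sub_le _ _
        _ = 1 + 1 + |t| := by rw [h1, norm_one, hn]
    nlinarith [mul_pos (by positivity : (0 : ℝ) < 3 * |t| + 2) (sub_pos.mpr h), abs_nonneg t]

omit [NeZero N] [NeZero R] in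
/-- the lattice derivative symbol against its continuum value: `‖n(e^{iy/n} − 1) − iy‖ ≤ 3y²/n`.
[folklore] -/
theorem norm_latDeriv_sub_le {n : ℕ} (hn : 1 ≤ n) (y : ℝ) :
    ‖(n : ℂ) * (Complex.exp (((y / n : ℝ) : ℂ) * I) - 1) - (y : ℂ) * I‖ ≤ 3 * y ^ 2 / n := by
  have hn0 : (0 : ℝ) < n := by exact_mod_cast hn
  have hn' : (n : ℂ) ≠ 0 := by exact_mod_cast hn0.ne'
  have ht : (n : ℂ) * (((y / n : ℝ) : ℂ) * I) = (y : ℂ) * I := by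
    push_cast; field_simp
  have e : (n : ℂ) * (Complex.exp (((y / n : ℝ) : ℂ) * I) - 1) - (y : ℂ) * I
      = (n : ℂ) * (Complex.exp (((y / n : ℝ) : ℂ) * I) - 1 - ((y / n : ℝ) : ℂ) * I) := by
    rw [← ht]; ring
  rw [e, norm_mul, Complex.norm_natCast]
  calc (n : ℝ) * ‖Complex.exp (((y / n : ℝ) : ℂ) * I) - 1 - ((y / n : ℝ) : ℂ) * I‖
      ≤ n * (3 * (y / n) ^ 2) := mul_le_mul_of_nonneg_left (norm_exp_mul_I_sub_one_sub_le _) hn0.le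
    _ = 3 * y ^ 2 / n := by field_simp

omit [NeZero N] [NeZero R] in
/-- `∂^{(n)}_ν` through the SYMMETRIC alias representative (`2πn`-periodicity of `e^{iq/n}`):
`dSym n k p′ ν = n(e^{i q̃_ν/n} − 1)`, `q̃ = symmAlias n k p′`. [cite: Balaban1984PropagatorsI, (1.31) p.23;
King1986, p.670] [folklore] -/
theorem dSym_eq_symmAlias {n : ℕ} (hn : 1 ≤ n) (k : Fin d → Fin n) (s : Fin d → ℝ) (ν : Fin d) :
    dSym n k s ν = (n : ℂ) * (Complex.exp (((symmAlias n k s ν / n : ℝ) : ℂ) * I) - 1) := by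
  have hn0 : (n : ℝ) ≠ 0 := by exact_mod_cast (by omega : n ≠ 0)
  have e : symmAlias n k s ν / n = shiftr n k s ν / n - (symmShift n k s ν : ℕ) * (2 * Real.pi) := by
    unfold King1986.symmAlias; field_simp
  have e2 : (((symmAlias n k s ν / n : ℝ)) : ℂ) * I
      = ((shiftr n k s ν / n : ℝ) : ℂ) * I - (symmShift n k s ν : ℂ) * (2 * Real.pi * I) := by
    rw [e]; push_cast; ring
  have key : Complex.exp (((symmAlias n k s ν / n : ℝ) : ℂ) * I)
      = Complex.exp (((shiftr n k s ν / n : ℝ) : ℂ) * I) := by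
    rw [e2, Complex.exp_sub, Complex.exp_nat_mul_two_pi_mul_I, div_one]
  rw [key]; rfl

omit [NeZero N] [NeZero R] in
/-- **`|∂^{(n)}_ν(q)| ≤ ‖q̃‖_∞`**: `|∂^{(n)}_ν(q)|² = S_ξ(q̃_ν) ≤ q̃_ν² ≤ ‖q̃‖²`. [folklore] -/
theorem norm_dSym_le {n : ℕ} (hn : 1 ≤ n) (k : Fin d → Fin n) (s : Fin d → ℝ) (ν : Fin d) :
    ‖dSym n k s ν‖ ≤ ‖symmAlias n k s‖ := by
  have h1 : ‖dSym n k s ν‖ ^ 2 = Sxir n (symmAlias n k s ν) := by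
    rw [dSym_eq_symmAlias hn, norm_mul, mul_pow, Complex.norm_natCast, norm_exp_mul_I_sub_one_sq,
      Sxir_eq_sq_mul_S1r]
  have h2 : Sxir n (symmAlias n k s ν) ≤ ‖symmAlias n k s‖ ^ 2 := by
    refine (Sxir_le n _).trans ?_
    rw [← sq_abs, ← Real.norm_eq_abs]
    exact pow_le_pow_left₀ (norm_nonneg _) (norm_le_pi_norm (symmAlias n k s) ν) 2
  rw [← h1] at h2
  exact (pow_le_pow_iff_left₀ (norm_nonneg _) (norm_nonneg _) two_ne_zero).mp h2

omit [NeZero N] in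
/-- **the η-rate of the order-one weight between PAIRED classes**:
`|∂^{(RN)}_ν(ι k) − ∂^{(N)}_ν(k)| ≤ 6‖q̃_k‖²/N` (both are `n(e^{i q̃_ν/n} − 1)` at the SAME `q̃`, `n = N, RN`,
each within `3q̃_ν²/n` of `i q̃_ν`). [cite: King1986, (4.29)–(4.31) p.673 (rate bookkeeping ours)] [folklore] -/
theorem dSym_rate_le (hN : 1 ≤ N) (hR : 1 ≤ R) (k : Fin d → Fin N) {s : Fin d → ℝ}
    (hs : ∀ ν, |s ν| ≤ Real.pi) (ν : Fin d) :
    ‖dSym (R * N) (iota R k s) s ν - dSym N k s ν‖ ≤ 6 * ‖symmAlias N k s‖ ^ 2 / N := by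
  have hN0 : (0 : ℝ) < N := by exact_mod_cast hN
  have hRN : 1 ≤ R * N := one_le_RN hN hR
  set y := symmAlias N k s ν with hy
  have e1 : dSym N k s ν = (N : ℂ) * (Complex.exp (((y / N : ℝ) : ℂ) * I) - 1) :=
    dSym_eq_symmAlias hN k s ν
  have e2 : dSym (R * N) (iota R k s) s ν
      = ((R * N : ℕ) : ℂ) * (Complex.exp (((y / (R * N : ℕ) : ℝ) : ℂ) * I) - 1) := by
    rw [dSym_eq_symmAlias hRN, symmAlias_iota hN k hs]
  have h1 := norm_latDeriv_sub_le hN y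
  have h2 := norm_latDeriv_sub_le hRN y
  have h3 : ‖dSym (R * N) (iota R k s) s ν - dSym N k s ν‖ ≤ 3 * y ^ 2 / (R * N : ℕ) + 3 * y ^ 2 / N := by
    rw [e1, e2]
    calc ‖((R * N : ℕ) : ℂ) * (Complex.exp (((y / (R * N : ℕ) : ℝ) : ℂ) * I) - 1)
            - (N : ℂ) * (Complex.exp (((y / N : ℝ) : ℂ) * I) - 1)‖
        = ‖(((R * N : ℕ) : ℂ) * (Complex.exp (((y / (R * N : ℕ) : ℝ) : ℂ) * I) - 1) - (y : ℂ) * I)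
            - ((N : ℂ) * (Complex.exp (((y / N : ℝ) : ℂ) * I) - 1) - (y : ℂ) * I)‖ := by
          congr 1; ring
      _ ≤ 3 * y ^ 2 / (R * N : ℕ) + 3 * y ^ 2 / N := (norm_sub_le _ _).trans (add_le_add h2 h1)
  have h4 : 3 * y ^ 2 / (R * N : ℕ) ≤ 3 * y ^ 2 / N := by
    apply div_le_div_of_nonneg_left (by positivity) hN0
    exact_mod_cast Nat.le_mul_of_pos_left N (by omega)
  have h5 : y ^ 2 ≤ ‖symmAlias N k s‖ ^ 2 := by
    rw [← sq_abs, ← Real.norm_eq_abs]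
    exact pow_le_pow_left₀ (norm_nonneg _) (norm_le_pi_norm (symmAlias N k s) ν) 2
  calc ‖dSym (R * N) (iota R k s) s ν - dSym N k s ν‖
      ≤ 3 * y ^ 2 / (R * N : ℕ) + 3 * y ^ 2 / N := h3
    _ ≤ 3 * y ^ 2 / N + 3 * y ^ 2 / N := add_le_add h4 le_rfl
    _ = 6 * y ^ 2 / N := by ring
    _ ≤ 6 * ‖symmAlias N k s‖ ^ 2 / N := by gcongr

/-- **(1.89)'s `∇_ν G`, x-part, uniform**: `Σ_{k≠0} |∂^{(N)}_ν(k)·xP^{(N)}_μ(q_k)|² ≤ (CXa/π)²·CW`.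
[cite: Balaban1984PropagatorsI, Prop. 1.1 (1.89) p.33 (item ‖∇GJ‖; ℓ² bookkeeping ours)] [folklore] -/
theorem xVec_sq_le_dSym (hN : 1 ≤ N) {s : Fin d → ℝ} (hs : ∀ ν, |s ν| ≤ Real.pi) (ν₀ : Fin d)
    (hν₀ : s ν₀ ≠ 0) (μ ν : Fin d) :
    ∑ k ∈ Finset.univ.erase (0 : Fin d → Fin N), ‖dSym N k s ν * xP N μ (symmAlias N k s)‖ ^ 2
      ≤ (CXa d / Real.pi) ^ 2 * CW d :=
  xVec_sq_le hN hs ν₀ hν₀ μ fun k => norm_dSym_le hN k s ν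

/-- **(1.89)'s `∇_ν G`, x-part, unpaired tail at level `RN`**: `≤ (CXa/(πN))²·CW`. [folklore] -/
theorem xVec_unpaired_sq_le_dSym (hN : 1 ≤ N) (hR : 1 ≤ R) {s : Fin d → ℝ} (hs : ∀ ν, |s ν| ≤ Real.pi)
    (ν₀ : Fin d) (hν₀ : s ν₀ ≠ 0) (μ ν : Fin d) :
    ∑ k'' ∈ Finset.univ.filter (fun k'' => ∀ k : Fin d → Fin N, iota R k s ≠ k''),
        ‖dSym (R * N) k'' s ν * xP (R * N) μ (symmAlias (R * N) k'' s)‖ ^ 2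
      ≤ (CXa d / (Real.pi * N)) ^ 2 * CW d :=
  xVec_unpaired_sq_le hN hR hs ν₀ hν₀ μ fun k'' => norm_dSym_le (one_le_RN hN hR) k'' s ν

/-- **(1.89)'s `∇_ν G`, x-part, η-RATE in `ℓ²` (squared) = `O(N⁻²)`**:
`Σ_{k≠0} |∂^{(N)}_ν(k)·xP^{(N)}_μ(q_k) − ∂^{(RN)}_ν(ιk)·xP^{(RN)}_μ(q_k)|² ≤ 2((Ax·d·CXa)² + (6CXa)²)·CW/N²`.
[cite: Balaban1984PropagatorsI, (1.83) p.31, Prop. 1.1 (1.89) p.33; King1986, (4.19)–(4.24) p.672,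
(4.29)–(4.31) p.673 (rate bookkeeping ours)] [folklore] -/
theorem xVec_rate_sq_le_dSym (hN : 1 ≤ N) (hR : 1 ≤ R) {s : Fin d → ℝ} (hs : ∀ ν, |s ν| ≤ Real.pi)
    (ν₀ : Fin d) (hν₀ : s ν₀ ≠ 0) (μ ν : Fin d) :
    ∑ k ∈ Finset.univ.erase (0 : Fin d → Fin N),
        ‖dSym N k s ν * xP N μ (symmAlias N k s)
          - dSym (R * N) (iota R k s) s ν * xP (R * N) μ (symmAlias N k s)‖ ^ 2
      ≤ 2 * ((Ax d * d * CXa d) ^ 2 + (6 * CXa d) ^ 2) * CW d / (N : ℝ) ^ 2 :=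
  xVec_rate_sq_le hN hR hs ν₀ hν₀ μ (wN := fun k => dSym N k s ν) (wR := fun k'' => dSym (R * N) k'' s ν)
    (by norm_num) (fun k => norm_dSym_le hN k s ν) (fun k => dSym_rate_le hN hR k hs ν)

/-- **(1.89)'s `∇_ν G`, bracket part, uniform (all classes)**:
`Σ_k |∂^{(N)}_ν(k)·bR^{(N)}_μ(q_k)|² ≤ π²(π·MrS)² + (CBa/π)²·CW`. [folklore] -/
theorem bVec_sq_le_dSym (hN : 1 ≤ N) (a : ℝ) (ha : 0 < a) {s : Fin d → ℝ} (hs : ∀ ν, |s ν| ≤ Real.pi)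
    (ν₀ : Fin d) (hν₀ : s ν₀ ≠ 0) (μ ν : Fin d) :
    ∑ k : Fin d → Fin N, ‖dSym N k s ν * bR N a μ (symmAlias N k s) s‖ ^ 2
      ≤ Real.pi ^ 2 * (Real.pi * MrS d a) ^ 2 + (CBa d / Real.pi) ^ 2 * CW d :=
  bVec_sq_le hN a ha hs ν₀ hν₀ μ fun k => norm_dSym_le hN k s ν

/-- **(1.89)'s `∇_ν G`, bracket part, unpaired tail at level `RN`**: `≤ (CBa/(πN))²·CW`. [folklore] -/
theorem bVec_unpaired_sq_le_dSym (hN : 1 ≤ N) (hR : 1 ≤ R) (a : ℝ) (ha : 0 < a) {s : Fin d → ℝ}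
    (hs : ∀ ν, |s ν| ≤ Real.pi) (ν₀ : Fin d) (hν₀ : s ν₀ ≠ 0) (μ ν : Fin d) :
    ∑ k'' ∈ Finset.univ.filter (fun k'' => ∀ k : Fin d → Fin N, iota R k s ≠ k''),
        ‖dSym (R * N) k'' s ν * bR (R * N) a μ (symmAlias (R * N) k'' s) s‖ ^ 2
      ≤ (CBa d / (Real.pi * N)) ^ 2 * CW d :=
  bVec_unpaired_sq_le hN hR a ha hs ν₀ hν₀ μ fun k'' => norm_dSym_le (one_le_RN hN hR) k'' s ν

/-- **(1.89)'s `∇_ν G`, bracket part, η-RATE in `ℓ²` (squared) = `O(N⁻²)`** (all classes):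
`Σ_k |∂^{(N)}_ν(k)·bR^{(N)}_μ(q_k) − ∂^{(RN)}_ν(ιk)·bR^{(RN)}_μ(q_k)|² ≤ CbRate(d,a,6)/N²`.
[cite: Balaban1984PropagatorsI, (1.83) p.31, (1.88) p.32, Prop. 1.1 (1.89) p.33; King1986, (4.19)–(4.24)
p.672 (rate bookkeeping ours)] [folklore] -/
theorem bVec_rate_sq_le_dSym (hN : 1 ≤ N) (hR : 1 ≤ R) (a : ℝ) (ha : 0 < a) {s : Fin d → ℝ}
    (hs : ∀ ν, |s ν| ≤ Real.pi) (ν₀ : Fin d) (hν₀ : s ν₀ ≠ 0) (μ ν : Fin d) :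
    ∑ k : Fin d → Fin N,
        ‖dSym N k s ν * bR N a μ (symmAlias N k s) s
          - dSym (R * N) (iota R k s) s ν * bR (R * N) a μ (symmAlias N k s) s‖ ^ 2
      ≤ CbRate d a 6 / (N : ℝ) ^ 2 :=
  bVec_rate_sq_le hN hR a ha hs ν₀ hν₀ μ (wN := fun k => dSym N k s ν) (wR := fun k'' => dSym (R * N) k'' s ν)
    (by norm_num) (fun k => norm_dSym_le hN k s ν) (fun k => dSym_rate_le hN hR k hs ν)

end DSym

end Literature.MathematicalPhysics.QuantumFieldTheory.Balaban1983to89.B5G183RateL2
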